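import Summits.QuantumFields.BalabanUV.Beta.EriceFlowEnclosureB12AsPrintedHistoryContagionShiftFlowZeroSemigroup

/-!
# Beta / EriceFlowEnclosureB12AsPrintedHistoryContagionShiftFlowZeroSemigroupOneLoop — ASYMPTOTIC FREEDOM IS CONTAGIOUS, part 51: THE CONTINUOUS RUNNING COUPLING — CONTINUITY IN
# THE SCALE, CONDITIONING IN THE COUPLING, THE CONTINUOUS ONE-LOOP LAW AND THE CLOCK WITH ITS RATE.  Part 46 built the continuous renormalization group `φ_s = Λ⁻¹∘(Λ + sβ₀)`
# on ]0, e′] and its continuous clock `sβ₀·φ_s(g)² → 1`; part 47 showed it canonical.  Here the quantitative companions.  §79, ABSTRACT (Λ strictly antitone on ]0, e′] onto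
# `[Λ e′, ∞[` with part 35's two-sided chart bounds `(2∕3)Δ ≤ ΔΛ ≤ (4∕3)Δ`): the continuous running coupling is **(3∕2)β₀-LIPSCHITZ IN THE SCALE in the chart**,
# `|1∕φ_{s′}(g)² − 1∕φ_s(g)²| ≤ (3∕2)β₀|s′ − s|` (`abs_rg_chart_sub_chart_le`), hence **`s ↦ φ_s g` IS CONTINUOUS on [0, ∞[** (`rg_continuousOn`) — the discrete RG with memory
# interpolates to a genuinely continuous scale dependence of the coupling; and each `φ_s` is **2-BI-LIPSCHITZ IN THE CHART, UNIFORMLY IN s** (`rg_chart_biLipschitz`: `½Δ ≤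
# Δ(φ_s) ≤ 2Δ` — the conditioning of part 14 transported to all real scales).  §80, FOR THE FLOW (from ONE AF reference and part 14's package at e′, Λ a dynamical Abel
# function): THE CONTINUOUS ONE-LOOP LAW **`|1∕φ_s(g)² − 1∕e′² − (Λ g − Λ e′) − sβ₀| ≤ (8C_m∕((1−θ)β*))∕φ_s(g) + κe′(β₀ + C_mγ∕(1−θ))`** (`abs_rg_oneLoop_le`: part 44's asymptotic
# scaling read at the point φ_s g — the continuous running coupling climbs the chart at speed β₀ with a square-root defect, exactly like every discrete trajectory in part 33),
# and THE CONTINUOUS CLOCK WITH ITS RATE **`|sβ₀·φ_s(g)² − 1| ≤ L·φ_s(g) + (M + 1∕e′² + Λ g − Λ e′)·φ_s(g)²`** (`abs_clock_sub_one_le`) — O(s^{−1∕2}).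
# Abstract in B (β-flow team, prover 1, unit `b2b-balaban-beta-bflow-p1`, gen 40; ROW AP-I·Uc × NODE U2 × ROW Λ — quantitative continuous RG)

HONEST FRAMING (page 1 of everything the β sub-cell writes): discharging `BetaPertH` makes Bałaban's UV stability UNCONDITIONAL — a
real constructive-QFT result; it is NOT the continuum limit and NOT the Clay problem.  HONEST DEPENDENCY (cell reorg 2026-08-19,
verbatim): «continuum YM on T⁴ ⇐ BetaPertH ∧ nine spine estimates (0/9 proved); BetaPertH ⇐ (D1) ∧ (D4) ∧ CAP+tail; G-an2-4 gates
asym, D1 and NE2/3/4.»  THIS MODULE DISCHARGES NOTHING: elementary real analysis (continuity of `x ↦ (1∕x)^{1∕2}`-type inversions, a Lipschitz estimate, algebra) over node U2's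
HYPOTHESIS SHAPES on an ABSTRACT functional `B`; part 46's `rg_mem_eq ∕ rg_lt_rg_of_lt`, part 44's `abs_dynAbel_sub_chart_le`, part 35's `relativeLambda_exists` BY NAME —
nothing restated.  `ScaleShiftRate` (GAPS G-t4-U2-1), `HistLipschitz`∕`FadingMemory` (G-t4-U2-2), [I] THEOREM 2 (p. 259, STATED WITHOUT PROOF) do not occur in this abstract part;
NOTHING is asserted about Bałaban's actual β; the semigroup acts on COUPLINGS near the zero pin, not on effective actions.  [I] = T. Bałaban, Commun. Math. Phys. **109** (1987)
249–301 [Balaban1987RG1].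

WHAT THIS FILE PROVES (0 sorry, 0 def): §79 **`abs_rg_chart_sub_chart_le`**, **`rg_continuousOn`**, **`rg_chart_biLipschitz`**; §80 **`abs_rg_oneLoop_le`**, **`abs_clock_sub_one_le`**.
NOT CLAIMED: differentiability in s (an infinitesimal β-function) — it would need a derivative hypothesis on B that is not typed; anything about Bałaban's β; `BetaPertH`;
continuum; Clay.
-/

namespace Summit.QuantumFields.BalabanUV.Beta.EriceFlowEnclosureB12AsPrintedHistoryContagionShiftFlowZeroSemigroupOneLoop

open Filter Topology Set Function
open Literature.MathematicalPhysics.QuantumFieldTheory.Balaban1983to89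
open Literature.MathematicalPhysics.QuantumFieldTheory.Balaban1983to89.T4BetaStationary (SeqBox MemoryProfile)
open Literature.MathematicalPhysics.QuantumFieldTheory.Balaban1983to89.T4BetaFlowWellPosed (MemFlow solution)
open Summit.QuantumFields.BalabanUV.Beta.EriceFlowEnclosureB12AsPrintedHistoryContagionShiftFlowZeroIsometry (abs_dynAbel_sub_chart_le)
open Summit.QuantumFields.BalabanUV.Beta.EriceFlowEnclosureB12AsPrintedHistoryContagionShiftFlowZeroSemigroup (rg_mem_eq rg_lt_rg_of_lt rg_le_self)

noncomputable section

/-! ## §79 Continuity in the scale and conditioning in the coupling (abstract) -/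

variable {Λ : ℝ → ℝ} {e' β₀ : ℝ}

/-- **THE CONTINUOUS RUNNING COUPLING IS (3∕2)β₀-LIPSCHITZ IN THE SCALE, IN THE CHART**: Λ strictly antitone on ]0, e′] onto `[Λ e′, ∞[` with the upper chart bound
`Λ e₁ − Λ e₂ ≥ (2∕3)(1∕e₁² − 1∕e₂²)` for `e₁ ≤ e₂` (part 35); then for `g ∈ ]0, e′]` and `s, s′ ≥ 0`: `|1∕φ_{s′}(g)² − 1∕φ_s(g)²| ≤ (3∕2)β₀·|s′ − s|`. [folklore] -/
theorem abs_rg_chart_sub_chart_le (hanti : StrictAntiOn Λ (Ioc 0 e')) (honto : ∀ y : ℝ, Λ e' ≤ y → ∃ x ∈ Ioc (0 : ℝ) e', Λ x = y) (hβ₀ : 0 < β₀)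
    (hlo : ∀ e₁ ∈ Ioc (0 : ℝ) e', ∀ e₂ ∈ Ioc (0 : ℝ) e', e₁ ≤ e₂ → 2 / 3 * (1 / e₁ ^ 2 - 1 / e₂ ^ 2) ≤ Λ e₁ - Λ e₂)
    {g s s' : ℝ} (hg : g ∈ Ioc (0 : ℝ) e') (hs : 0 ≤ s) (hs' : 0 ≤ s') :
    |1 / invFunOn Λ (Ioc 0 e') (Λ g + s' * β₀) ^ 2 - 1 / invFunOn Λ (Ioc 0 e') (Λ g + s * β₀) ^ 2| ≤ 3 / 2 * β₀ * |s' - s| := by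
  -- w.l.o.g. by symmetry treat s ≤ s′ and s′ ≤ s alike
  have key : ∀ a b : ℝ, 0 ≤ a → a ≤ b →
      0 ≤ 1 / invFunOn Λ (Ioc 0 e') (Λ g + b * β₀) ^ 2 - 1 / invFunOn Λ (Ioc 0 e') (Λ g + a * β₀) ^ 2 ∧
      1 / invFunOn Λ (Ioc 0 e') (Λ g + b * β₀) ^ 2 - 1 / invFunOn Λ (Ioc 0 e') (Λ g + a * β₀) ^ 2 ≤ 3 / 2 * β₀ * (b - a) := by
    intro a b ha hab
    obtain ⟨ma, ea⟩ := rg_mem_eq hanti honto hβ₀.le hg ha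
    obtain ⟨mb, eb⟩ := rg_mem_eq hanti honto hβ₀.le hg (ha.trans hab)
    have hle : invFunOn Λ (Ioc 0 e') (Λ g + b * β₀) ≤ invFunOn Λ (Ioc 0 e') (Λ g + a * β₀) := by
      rcases eq_or_lt_of_le hab with h | h
      · rw [h]
      · exact (rg_lt_rg_of_lt hanti honto hβ₀ hg ha h).le
    have h1 := hlo _ mb _ ma hle
    rw [ea, eb] at h1
    have hΔ0 : 0 ≤ 1 / invFunOn Λ (Ioc 0 e') (Λ g + b * β₀) ^ 2 - 1 / invFunOn Λ (Ioc 0 e') (Λ g + a * β₀) ^ 2 := by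
      rw [sub_nonneg]; exact one_div_le_one_div_of_le (pow_pos mb.1 2) (pow_le_pow_left₀ mb.1.le hle 2)
    exact ⟨hΔ0, by nlinarith⟩
  rcases le_total s s' with h | h
  · obtain ⟨h0, h1⟩ := key s s' hs h
    rw [abs_of_nonneg h0, abs_of_nonneg (sub_nonneg.mpr h)]; exact h1
  · obtain ⟨h0, h1⟩ := key s' s hs' h
    rw [abs_sub_comm, abs_of_nonneg h0, abs_sub_comm, abs_of_nonneg (sub_nonneg.mpr h)]; exact h1

/-- **THE CONTINUOUS RUNNING COUPLING IS CONTINUOUS IN THE SCALE**: under the data of `abs_rg_chart_sub_chart_le`, `s ↦ φ_s g` is continuous on `[0, ∞[` (its chart is Lipschitz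
and the map `x ↦ 1∕x²` is a homeomorphism of ]0, ∞[). [folklore] -/
theorem rg_continuousOn (hanti : StrictAntiOn Λ (Ioc 0 e')) (honto : ∀ y : ℝ, Λ e' ≤ y → ∃ x ∈ Ioc (0 : ℝ) e', Λ x = y) (hβ₀ : 0 < β₀)
    (hlo : ∀ e₁ ∈ Ioc (0 : ℝ) e', ∀ e₂ ∈ Ioc (0 : ℝ) e', e₁ ≤ e₂ → 2 / 3 * (1 / e₁ ^ 2 - 1 / e₂ ^ 2) ≤ Λ e₁ - Λ e₂)
    {g : ℝ} (hg : g ∈ Ioc (0 : ℝ) e') :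
    ContinuousOn (fun s : ℝ => invFunOn Λ (Ioc 0 e') (Λ g + s * β₀)) (Ici 0) := by
  -- the chart `s ↦ 1∕φ_s(g)²` is Lipschitz on [0, ∞[, hence continuous there
  have hchart : ContinuousOn (fun s : ℝ => 1 / invFunOn Λ (Ioc 0 e') (Λ g + s * β₀) ^ 2) (Ici 0) := by
    refine Metric.continuousOn_iff.mpr fun s hs ε hε => ⟨ε / (3 / 2 * β₀ + 1), by positivity, fun s' hs' hd => ?_⟩
    rw [Real.dist_eq] at hd ⊢
    have h := abs_rg_chart_sub_chart_le hanti honto hβ₀ hlo hg hs hs'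
    have hpos : 0 < 3 / 2 * β₀ + 1 := by positivity
    calc |1 / invFunOn Λ (Ioc 0 e') (Λ g + s' * β₀) ^ 2 - 1 / invFunOn Λ (Ioc 0 e') (Λ g + s * β₀) ^ 2| ≤ 3 / 2 * β₀ * |s' - s| := h
      _ ≤ (3 / 2 * β₀ + 1) * |s' - s| := by nlinarith [abs_nonneg (s' - s)]
      _ < (3 / 2 * β₀ + 1) * (ε / (3 / 2 * β₀ + 1)) := mul_lt_mul_of_pos_left hd hpos
      _ = ε := mul_div_cancel₀ _ hpos.ne'
  -- invert the chart: φ = √(1 ∕ (1∕φ²))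
  have hne : ∀ s ∈ Ici (0 : ℝ), 1 / invFunOn Λ (Ioc 0 e') (Λ g + s * β₀) ^ 2 ≠ 0 := by
    intro s hs
    obtain ⟨m, -⟩ := rg_mem_eq hanti honto hβ₀.le hg hs
    exact (one_div_pos.mpr (pow_pos m.1 2)).ne'
  have hsqrt : ContinuousOn (fun s : ℝ => Real.sqrt (1 / (1 / invFunOn Λ (Ioc 0 e') (Λ g + s * β₀) ^ 2))) (Ici 0) :=
    Real.continuous_sqrt.comp_continuousOn (continuousOn_const.div hchart hne)
  refine hsqrt.congr fun s hs => ?_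
  obtain ⟨m, -⟩ := rg_mem_eq hanti honto hβ₀.le hg hs
  show invFunOn Λ (Ioc 0 e') (Λ g + s * β₀) = Real.sqrt (1 / (1 / invFunOn Λ (Ioc 0 e') (Λ g + s * β₀) ^ 2))
  rw [one_div_one_div, Real.sqrt_sq m.1.le]

/-- **EACH TIME-s MAP IS 2-BI-LIPSCHITZ IN THE CHART, UNIFORMLY IN s**: with part 35's two-sided chart bounds (2∕3, 4∕3) for Λ, for `0 < g ≤ g̃ ≤ e′` and `s ≥ 0`:
`½(1∕g² − 1∕g̃²) ≤ 1∕φ_s(g)² − 1∕φ_s(g̃)² ≤ 2(1∕g² − 1∕g̃²)` — the conditioning of part 14 at every real scale. [folklore] -/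
theorem rg_chart_biLipschitz (hanti : StrictAntiOn Λ (Ioc 0 e')) (honto : ∀ y : ℝ, Λ e' ≤ y → ∃ x ∈ Ioc (0 : ℝ) e', Λ x = y) (hβ₀ : 0 ≤ β₀)
    (hbounds : ∀ e₁ ∈ Ioc (0 : ℝ) e', ∀ e₂ ∈ Ioc (0 : ℝ) e', e₁ ≤ e₂ →
      2 / 3 * (1 / e₁ ^ 2 - 1 / e₂ ^ 2) ≤ Λ e₁ - Λ e₂ ∧ Λ e₁ - Λ e₂ ≤ 4 / 3 * (1 / e₁ ^ 2 - 1 / e₂ ^ 2))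
    {g g' s : ℝ} (hg : g ∈ Ioc (0 : ℝ) e') (hg' : g' ∈ Ioc (0 : ℝ) e') (hgg' : g ≤ g') (hs : 0 ≤ s) :
    1 / 2 * (1 / g ^ 2 - 1 / g' ^ 2) ≤ 1 / invFunOn Λ (Ioc 0 e') (Λ g + s * β₀) ^ 2 - 1 / invFunOn Λ (Ioc 0 e') (Λ g' + s * β₀) ^ 2 ∧
      1 / invFunOn Λ (Ioc 0 e') (Λ g + s * β₀) ^ 2 - 1 / invFunOn Λ (Ioc 0 e') (Λ g' + s * β₀) ^ 2 ≤ 2 * (1 / g ^ 2 - 1 / g' ^ 2) := by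
  obtain ⟨m₁, e₁⟩ := rg_mem_eq hanti honto hβ₀ hg hs
  obtain ⟨m₂, e₂⟩ := rg_mem_eq hanti honto hβ₀ hg' hs
  -- the images are ordered like the pins, and their Λ-difference equals that of the pins
  have hle : invFunOn Λ (Ioc 0 e') (Λ g + s * β₀) ≤ invFunOn Λ (Ioc 0 e') (Λ g' + s * β₀) := by
    refine (hanti.le_iff_ge m₂ m₁).mp ?_
    rw [e₁, e₂]
    linarith [(hanti.le_iff_ge hg' hg).mpr hgg']
  have hpins := hbounds g hg g' hg' hgg'
  have himgs := hbounds _ m₁ _ m₂ hle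
  rw [e₁, e₂] at himgs
  have e3 : Λ g + s * β₀ - (Λ g' + s * β₀) = Λ g - Λ g' := by ring
  rw [e3] at himgs
  constructor <;> nlinarith [hpins.1, hpins.2, himgs.1, himgs.2]

/-! ## §80 For the flow: the continuous one-loop law and the clock with its rate -/

/-- **THE CONTINUOUS ONE-LOOP LAW.**  `B` with memory profile `(C_m, θ)` on ]0, γ]^ℕ and the value β₀ at the zero history; ONE AF reference t; the reference pin e′ with part
14's package; a box solution h′ from e′; Λ a dynamical Abel function (any comparison sequence) that is strictly antitone on ]0, e′] and onto `[Λ e′, ∞[` (parts 35 ∕ 40).  THEN for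
`g ∈ ]0, e′]` and `s ≥ 0`, with `φ_s g = invFunOn Λ (Ioc 0 e′) (Λ g + sβ₀)`:
**`|1∕φ_s(g)² − 1∕e′² − (Λ g − Λ e′) − sβ₀| ≤ (8C_m∕((1−θ)β*))∕φ_s(g) + (64C_m∕(3(1−θ)β*))·e′·(β₀ + C_mγ∕(1−θ))`** — the continuous running coupling climbs the chart at speed β₀
with the square-root defect of part 33, uniformly in the pin (part 44's scaling read at the point φ_s g). [folklore] -/
theorem abs_rg_oneLoop_le {B : (ℕ → ℝ) → ℝ} {Cm θ γ β₀ bs ta gs e' : ℝ} {t h' : ℕ → ℝ} {a : ℕ → ℝ} {Λ : ℝ → ℝ}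
    (hB : MemoryProfile Cm θ γ B) (hCm : 0 ≤ Cm) (hθ0 : 0 ≤ θ) (hθ1 : θ < 1) (hbs : 0 < bs) (hta : 0 < ta)
    (h0 : ∀ u : ℕ → ℝ, SeqBox γ u → |B u - β₀| ≤ Cm * ∑' j, θ ^ j * u j)
    (hts : SeqBox γ t) (htf : MemFlow B gs t) (hprof : ∀ m : ℕ, 1 / ta ^ 2 + bs * (m : ℝ) ≤ 1 / (t m) ^ 2)
    (hΛ : ∀ e ∈ Ioc (0 : ℝ) e', ∀ h : ℕ → ℝ, SeqBox γ h → MemFlow B e h → Tendsto (fun n => 1 / h n ^ 2 - a n) atTop (𝓝 (Λ e)))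
    (hanti : StrictAntiOn Λ (Ioc 0 e')) (honto : ∀ y : ℝ, Λ e' ≤ y → ∃ x ∈ Ioc (0 : ℝ) e', Λ x = y)
    (he' : 0 < e') (h2e' : 2 * e' ≤ γ)
    (hs1 : 4 * Cm * e' ≤ bs * (1 - θ))
    (hs2 : e' ^ 2 * (1 / gs ^ 2 + Cm * γ / (1 - θ) ^ 2 + (2 * Cm / ((1 - θ) * bs)) ^ 2) ≤ 3 / 4)
    (hs4 : 64 * Cm * e' ^ 3 ≤ (1 - θ) ^ 2) (hs5 : Cm * (8 * e' ^ 3 + 16 * e' / bs) ≤ (1 - θ) / 4)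
    (hhs' : SeqBox γ h') (hhf' : MemFlow B e' h') {g s : ℝ} (hg : g ∈ Ioc (0 : ℝ) e') (hs : 0 ≤ s) :
    |1 / invFunOn Λ (Ioc 0 e') (Λ g + s * β₀) ^ 2 - 1 / e' ^ 2 - (Λ g - Λ e') - s * β₀|
      ≤ 8 * Cm / ((1 - θ) * bs) * (1 / invFunOn Λ (Ioc 0 e') (Λ g + s * β₀)) + 64 * Cm / (3 * (1 - θ) * bs) * e' * (β₀ + Cm * γ / (1 - θ)) := by
  have hβ₀ : 0 < β₀ :=
    EriceFlowEnclosureB12AsPrintedHistoryContagionShiftFlowZero.valueAtZero_pos hCm hθ0 hθ1 hbs hta h0 hts htf hprof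
  obtain ⟨m₁, e₁⟩ := rg_mem_eq hanti honto hβ₀.le hg hs
  have h := abs_dynAbel_sub_chart_le hB hCm hθ0 hθ1 hbs hta h0 hts htf hprof hΛ he' h2e' hs1 hs2 hs4 hs5 hhs' hhf' m₁.1 m₁.2
  rw [e₁] at h
  calc |1 / invFunOn Λ (Ioc 0 e') (Λ g + s * β₀) ^ 2 - 1 / e' ^ 2 - (Λ g - Λ e') - s * β₀|
      = |Λ g + s * β₀ - Λ e' - (1 / invFunOn Λ (Ioc 0 e') (Λ g + s * β₀) ^ 2 - 1 / e' ^ 2)| := by rw [abs_sub_comm]; ring_nf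
    _ ≤ _ := h

/-- **THE CONTINUOUS CLOCK WITH ITS RATE.**  Under the data of `abs_rg_oneLoop_le`, writing `L = 8C_m∕((1−θ)β*)`, `M = (64C_m∕(3(1−θ)β*))·e′·(β₀ + C_mγ∕(1−θ))`:
**`|sβ₀·φ_s(g)² − 1| ≤ L·φ_s(g) + (M + 1∕e′² + (Λ g − Λ e′))·φ_s(g)²`** — since `φ_s(g)² ≤` const∕s (part 46's chart rates), the continuous clock `sβ₀·φ_s(g)² → 1` of part 46
holds with rate O(s^{−1∕2}). [folklore] -/
theorem abs_clock_sub_one_le {B : (ℕ → ℝ) → ℝ} {Cm θ γ β₀ bs ta gs e' : ℝ} {t h' : ℕ → ℝ} {a : ℕ → ℝ} {Λ : ℝ → ℝ}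
    (hB : MemoryProfile Cm θ γ B) (hCm : 0 ≤ Cm) (hθ0 : 0 ≤ θ) (hθ1 : θ < 1) (hbs : 0 < bs) (hta : 0 < ta)
    (h0 : ∀ u : ℕ → ℝ, SeqBox γ u → |B u - β₀| ≤ Cm * ∑' j, θ ^ j * u j)
    (hts : SeqBox γ t) (htf : MemFlow B gs t) (hprof : ∀ m : ℕ, 1 / ta ^ 2 + bs * (m : ℝ) ≤ 1 / (t m) ^ 2)
    (hΛ : ∀ e ∈ Ioc (0 : ℝ) e', ∀ h : ℕ → ℝ, SeqBox γ h → MemFlow B e h → Tendsto (fun n => 1 / h n ^ 2 - a n) atTop (𝓝 (Λ e)))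
    (hanti : StrictAntiOn Λ (Ioc 0 e')) (honto : ∀ y : ℝ, Λ e' ≤ y → ∃ x ∈ Ioc (0 : ℝ) e', Λ x = y)
    (he' : 0 < e') (h2e' : 2 * e' ≤ γ)
    (hs1 : 4 * Cm * e' ≤ bs * (1 - θ))
    (hs2 : e' ^ 2 * (1 / gs ^ 2 + Cm * γ / (1 - θ) ^ 2 + (2 * Cm / ((1 - θ) * bs)) ^ 2) ≤ 3 / 4)
    (hs4 : 64 * Cm * e' ^ 3 ≤ (1 - θ) ^ 2) (hs5 : Cm * (8 * e' ^ 3 + 16 * e' / bs) ≤ (1 - θ) / 4)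
    (hhs' : SeqBox γ h') (hhf' : MemFlow B e' h') {g s : ℝ} (hg : g ∈ Ioc (0 : ℝ) e') (hs : 0 ≤ s) :
    |s * β₀ * invFunOn Λ (Ioc 0 e') (Λ g + s * β₀) ^ 2 - 1|
      ≤ 8 * Cm / ((1 - θ) * bs) * invFunOn Λ (Ioc 0 e') (Λ g + s * β₀)
        + (64 * Cm / (3 * (1 - θ) * bs) * e' * (β₀ + Cm * γ / (1 - θ)) + 1 / e' ^ 2 + (Λ g - Λ e')) * invFunOn Λ (Ioc 0 e') (Λ g + s * β₀) ^ 2 := by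
  have h1θ : 0 < 1 - θ := by linarith
  have hβ₀ : 0 < β₀ :=
    EriceFlowEnclosureB12AsPrintedHistoryContagionShiftFlowZero.valueAtZero_pos hCm hθ0 hθ1 hbs hta h0 hts htf hprof
  have he'mem : e' ∈ Ioc (0 : ℝ) e' := ⟨he', le_rfl⟩
  obtain ⟨m₁, e₁⟩ := rg_mem_eq hanti honto hβ₀.le hg hs
  have h := abs_rg_oneLoop_le hB hCm hθ0 hθ1 hbs hta h0 hts htf hprof hΛ hanti honto he' h2e' hs1 hs2 hs4 hs5 hhs' hhf' hg hs
  set x : ℝ := invFunOn Λ (Ioc 0 e') (Λ g + s * β₀) with hx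
  set L : ℝ := 8 * Cm / ((1 - θ) * bs) with hL
  set M : ℝ := 64 * Cm / (3 * (1 - θ) * bs) * e' * (β₀ + Cm * γ / (1 - θ)) with hM
  have hx0 : 0 < x := m₁.1
  have hx2 : 0 < x ^ 2 := pow_pos hx0 2
  have hΛge : Λ e' ≤ Λ g := hanti.antitoneOn hg he'mem hg.2
  -- multiply the one-loop law by x²
  obtain ⟨hlo, hhi⟩ := abs_le.mp h
  have hid : s * β₀ * x ^ 2 - 1 = -(x ^ 2 * (1 / x ^ 2 - 1 / e' ^ 2 - (Λ g - Λ e') - s * β₀)) - x ^ 2 * (1 / e' ^ 2 + (Λ g - Λ e')) := by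
    field_simp; ring
  rw [hid, abs_le]
  have hc0 : 0 ≤ x ^ 2 * (1 / e' ^ 2 + (Λ g - Λ e')) := by
    have : 0 ≤ 1 / e' ^ 2 + (Λ g - Λ e') := by have := one_div_pos.mpr (pow_pos he' 2); linarith
    positivity
  have hb1 : x ^ 2 * (1 / x ^ 2 - 1 / e' ^ 2 - (Λ g - Λ e') - s * β₀) ≤ x ^ 2 * (L * (1 / x) + M) := mul_le_mul_of_nonneg_left hhi hx2.le
  have hb2 : -(x ^ 2 * (L * (1 / x) + M)) ≤ x ^ 2 * (1 / x ^ 2 - 1 / e' ^ 2 - (Λ g - Λ e') - s * β₀) := by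
    have := mul_le_mul_of_nonneg_left hlo hx2.le; linarith
  have hexp : x ^ 2 * (L * (1 / x) + M) = L * x + M * x ^ 2 := by field_simp
  rw [hexp] at hb1 hb2
  constructor <;> nlinarith

end

end Summit.QuantumFields.BalabanUV.Beta.EriceFlowEnclosureB12AsPrintedHistoryContagionShiftFlowZeroSemigroupOneLoop
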